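import Mathlib.Topology.Sequences
import Mathlib.Topology.MetricSpace.Pseudo.Lemmas
import Mathlib.Order.Zorn
import HarnessLib

/-!
# Route ClusterCompleteness · crux `OmegaLimitMultiKerr` — Birkhoff's recurrence theorem
# (minimal sets and almost-periodic points of a flow on a compact pseudometric space)

Structure lemma for the crux stmt-FinalStateConjecture-14664 (`ClusterCompleteness.OmegaLimitMultiKerr`),
line `Sketch`, lead gen 6. The line reads the recur-disjunct of the generic ω-limit dichotomy as
"the reference multi-Kerr configuration is an ω-LIMIT POINT of the late-time translates of the
era-chart deviation fields" (`Cᵏ_loc` topology). Gens 3–5 kernel-checked that, for TAME era charts,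
the `Cᵏ_loc` ω-limit set is nonempty, closed, invariant under the Killing translation and
sequentially compact (Hale 1980, Ch. I §8, Thm. 8.1). This file supplies the abstract
topological-dynamics theorem that is applied to that set in
`…OmegaLimitMultiKerrUniformRecurrence`: **Birkhoff's recurrence theorem**.

* `exists_minimal_closed_invariant` — a nonempty compact space acted on by any family of self-maps
  contains a MINIMAL nonempty closed invariant subset (Zorn's lemma + Cantor's intersection theorem);
* `not_lt_dist_of_mem_minimal` / `almostPeriodic_of_mem_minimal` — every point of a minimal set of
  a flow `φ` (`φ (s + t) = φ s ∘ φ t`, each `φ s` continuous) on a compact pseudometric space is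
  ALMOST PERIODIC (uniformly recurrent): for every `ε > 0` the return times
  `{s | dist (φ s x) x < ε}` are relatively dense — every interval of some length `L` contains one;
* `exists_almostPeriodic` (registered structure stub, closed form) — hence every flow on a nonempty
  compact pseudometric space has an almost-periodic point.

G. D. Birkhoff, *Dynamical Systems*, AMS Colloq. Publ. IX (1927), Ch. VII §§1–2 ("recurrent
motions"; every compact invariant set contains a minimal set, whose motions are recurrent);
textbook form: Nemytskii–Stepanov, *Qualitative Theory of Differential Equations* (1960), Ch. V,
Thms. 7.03–7.07; J. K. Hale, *Ordinary Differential Equations* (1980), Ch. I §8 for ω-limit sets.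
Reading for the crux (see `…UniformRecurrence`): the dark limits of a tame non-settling development
may be taken UNIFORMLY RECURRENT in era gauge, so the rigidity input of the LaSalle re-line need only
address almost-periodic eternal vacuum ends — the almost-periodic extension of the published
"time-periodic ⇒ stationary" theorems (Papapetrou 1957; Bičák–Scholtz–Tod 2010; Alexakis–Schlue
2018) — instead of a transfer inequality. Everything here is proved from Mathlib alone; no
definitions.
-/

-- every `Summit.FinalStateConjecture.FinalStateConjecture.…` name repeats the summit = sub-problem segment (D-0017 layout)
set_option linter.dupNamespace false

open Set Filter Topology

namespace Summit.FinalStateConjecture.FinalStateConjecture.Theorems.ClusterCompleteness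

/-- **Minimal sets exist** (Birkhoff 1927, Ch. VII §1; Zorn's lemma form). A nonempty compact
space `X` carrying an arbitrary family of self-maps `φ i` contains a nonempty closed subset `M`
invariant under every `φ i` and MINIMAL with these properties: every nonempty closed invariant
`M' ⊆ M` equals `M`. Proof: the nonempty closed invariant subsets, ordered by reverse inclusion,
satisfy the chain condition by Cantor's intersection theorem
(`IsCompact.nonempty_sInter_of_directed_nonempty_isCompact_isClosed`), and `zorn_superset_nonempty`
applies below `univ`. [folklore] -/
theorem exists_minimal_closed_invariant {X : Type*} [TopologicalSpace X] [CompactSpace X]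
    [Nonempty X] {ι : Type*} (φ : ι → X → X) :
    ∃ M : Set X, M.Nonempty ∧ IsClosed M ∧ (∀ i, MapsTo (φ i) M M) ∧
      ∀ M' ⊆ M, M'.Nonempty → IsClosed M' → (∀ i, MapsTo (φ i) M' M') → M' = M := by
  set S : Set (Set X) := {M | M.Nonempty ∧ IsClosed M ∧ ∀ i, MapsTo (φ i) M M} with hS
  -- chain condition: the intersection of a nonempty chain of members of `S` is a member of `S`
  have hchain : ∀ c ⊆ S, IsChain (· ⊆ ·) c → c.Nonempty → ∃ lb ∈ S, ∀ s ∈ c, lb ⊆ s := by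
    intro c hcS hc hcne
    haveI : Nonempty c := hcne.to_subtype
    have hdir : DirectedOn (· ⊇ ·) c := by
      intro a ha b hb
      rcases hc.total ha hb with hab | hba
      · exact ⟨a, ha, le_rfl, hab⟩
      · exact ⟨b, hb, hba, le_rfl⟩
    refine ⟨⋂₀ c, ⟨?_, isClosed_sInter fun s hs ↦ (hcS hs).2.1, fun i x hx ↦ ?_⟩,
      fun s hs ↦ sInter_subset_of_mem hs⟩
    · exact IsCompact.nonempty_sInter_of_directed_nonempty_isCompact_isClosed hdir
        (fun s hs ↦ (hcS hs).1) (fun s hs ↦ (hcS hs).2.1.isCompact) fun s hs ↦ (hcS hs).2.1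
    · exact mem_sInter.2 fun s hs ↦ (hcS hs).2.2 i (mem_sInter.1 hx s hs)
  have huniv : (univ : Set X) ∈ S := ⟨univ_nonempty, isClosed_univ, fun i ↦ mapsTo_univ _ _⟩
  obtain ⟨m, -, hm⟩ := zorn_superset_nonempty S hchain univ huniv
  refine ⟨m, hm.prop.1, hm.prop.2.1, hm.prop.2.2, fun M' hM' hne hcl hinv ↦ ?_⟩
  exact Subset.antisymm hM' (hm.le_of_le (y := M') ⟨hne, hcl, hinv⟩ hM')

/-- **Orbit closures of a flow are closed invariant sets.** For a family `φ : ℝ → X → X` of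
continuous maps with the flow law `φ (s + t) = φ s ∘ φ t`, the closure of the orbit
`{φ s y | s}` of any point is mapped into itself by every `φ r` (`φ r (φ s y) = φ (r + s) y` and
`image_closure_subset_closure_image`). [folklore] -/
theorem mapsTo_closure_range_flow {X : Type*} [TopologicalSpace X] (φ : ℝ → X → X)
    (hφ : ∀ s, Continuous (φ s)) (hadd : ∀ s t x, φ (s + t) x = φ s (φ t x)) (y : X) (r : ℝ) :
    MapsTo (φ r) (closure (range fun s ↦ φ s y)) (closure (range fun s ↦ φ s y)) := by
  have himg : φ r '' range (fun s ↦ φ s y) ⊆ range fun s ↦ φ s y := by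
    rintro _ ⟨_, ⟨s, rfl⟩, rfl⟩
    exact ⟨r + s, hadd r s y⟩
  intro z hz
  exact closure_mono himg (image_closure_subset_closure_image (hφ r) ⟨z, hz, rfl⟩)

/-- **Points of a minimal set are almost periodic** (Birkhoff 1927, Ch. VII §2, Thm. "every
motion of a minimal set is recurrent"; Nemytskii–Stepanov 1960, Ch. V, Thm. 7.07), for a flow
`φ` on a pseudometric space with the flow law and each `φ s` continuous, and a COMPACT CLOSED
minimal set `M` (nonempty closed invariant subsets of `M` are all of `M`). If `x ∈ M` were not almost periodic,
some `ε > 0` would admit, for every `n`, an interval `[tₙ, tₙ + 2(n+1)]` free of `ε`-returns to `x`;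
a limit point `y ∈ M` of `φ (tₙ + n + 1) x` then has its WHOLE orbit at distance `≥ ε` from `x`
(continuity of `φ s`), so the orbit closure of `y` is a nonempty closed invariant subset of `M`
missing `x` — contradicting minimality. Stated as: for `x ∈ M` and `ε > 0` some length `L > 0`
works. [folklore] -/
theorem almostPeriodic_of_mem_minimal {X : Type*} [PseudoMetricSpace X] (φ : ℝ → X → X)
    (hφ : ∀ s, Continuous (φ s)) (hadd : ∀ s t x, φ (s + t) x = φ s (φ t x)) {M : Set X}
    (hMc : IsCompact M) (hMcl : IsClosed M) (hinv : ∀ s, MapsTo (φ s) M M)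
    (hmin : ∀ M' ⊆ M, M'.Nonempty → IsClosed M' → (∀ s, MapsTo (φ s) M' M') → M' = M)
    {x : X} (hx : x ∈ M) {ε : ℝ} (hε : 0 < ε) :
    ∃ L : ℝ, 0 < L ∧ ∀ t : ℝ, ∃ s ∈ Icc t (t + L), dist (φ s x) x < ε := by
  by_contra hcon
  push Not at hcon
  -- for every `n`, an interval of length `2 (n + 1)` without `ε`-returns
  have hbad : ∀ n : ℕ, ∃ t : ℝ, ∀ s ∈ Icc t (t + 2 * (n + 1)), ε ≤ dist (φ s x) x := fun n ↦
    hcon (2 * (n + 1)) (by positivity)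
  choose t ht using hbad
  -- midpoints `y n = φ (t n + (n + 1)) x ∈ M` and a convergent subsequence
  set y : ℕ → X := fun n ↦ φ (t n + (n + 1)) x with hy
  have hyM : ∀ n, y n ∈ M := fun n ↦ hinv _ hx
  obtain ⟨z, hzM, ψ, hψ, hlim⟩ := hMc.tendsto_subseq hyM
  -- the whole orbit of `z` stays at distance `≥ ε` from `x`
  have hfar : ∀ s : ℝ, ε ≤ dist (φ s z) x := by
    intro s
    have hconv : Tendsto (fun j ↦ dist (φ s (y (ψ j))) x) atTop (𝓝 (dist (φ s z) x)) :=
      (((hφ s).tendsto z).comp hlim).dist tendsto_const_nhds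
    refine ge_of_tendsto hconv ?_
    -- eventually `|s| ≤ ψ j + 1`, so `t (ψ j) + (ψ j + 1) + s ∈ [t (ψ j), t (ψ j) + 2 (ψ j + 1)]`
    obtain ⟨N, hN⟩ := exists_nat_ge |s|
    filter_upwards [eventually_ge_atTop N] with j hj
    have hψj : (N : ℝ) ≤ ψ j := by exact_mod_cast hj.trans hψ.le_apply
    have hs1 : -((ψ j : ℝ) + 1) ≤ s := by
      have := neg_abs_le s
      linarith
    have hs2 : s ≤ (ψ j : ℝ) + 1 := (le_abs_self s).trans (by linarith)
    have hmem : s + (t (ψ j) + (ψ j + 1)) ∈ Icc (t (ψ j)) (t (ψ j) + 2 * (ψ j + 1)) :=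
      ⟨by linarith, by linarith⟩
    have := ht (ψ j) _ hmem
    rwa [hadd] at this
  -- the orbit closure of `z`: nonempty, closed, invariant, inside `M`, hence `= M`
  set M' : Set X := closure (range fun s ↦ φ s z) with hM'
  have hM'sub : M' ⊆ M := closure_minimal (by rintro _ ⟨s, rfl⟩; exact hinv s hzM) hMcl
  have hM'ne : M'.Nonempty := ⟨φ 0 z, subset_closure ⟨0, rfl⟩⟩
  have hM'eq : M' = M :=
    hmin M' hM'sub hM'ne isClosed_closure (mapsTo_closure_range_flow φ hφ hadd z)
  -- but `x ∈ M = M'` lies in the closed set `{w | ε ≤ dist w x}`, i.e. `ε ≤ dist x x = 0`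
  have hxfar : x ∈ {w | ε ≤ dist w x} := by
    have hcl : IsClosed {w : X | ε ≤ dist w x} :=
      isClosed_le continuous_const (continuous_id.dist continuous_const)
    have hsub : M' ⊆ {w | ε ≤ dist w x} := closure_minimal (by rintro _ ⟨s, rfl⟩; exact hfar s) hcl
    exact hsub (hM'eq ▸ hx)
  have : ε ≤ dist x x := hxfar
  rw [dist_self] at this
  exact absurd this (not_le.2 hε)

/-- **Registered structure stub (crux stmt-FinalStateConjecture-14664, line `Sketch`, stub
`BirkhoffRecurrence`): Birkhoff's recurrence theorem.** A flow `φ : ℝ → X → X` on a nonempty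
compact pseudometric space — each `φ s` continuous, `φ (s + t) = φ s ∘ φ t` — has an
ALMOST-PERIODIC (uniformly recurrent) point `x`: for every `ε > 0` there is `L > 0` such that every
interval `[t, t + L]` contains a time `s` with `dist (φ s x) x < ε`. Proof: a minimal closed
invariant set exists (`exists_minimal_closed_invariant`) and each of its points is almost periodic
(`almostPeriodic_of_mem_minimal`). Birkhoff, *Dynamical Systems* (1927), Ch. VII §§1–2;
Nemytskii–Stepanov 1960, Ch. V, Thms. 7.03–7.07. Closed form. [folklore] -/
theorem exists_almostPeriodic :
    ∀ {X : Type*} [PseudoMetricSpace X] [CompactSpace X] [Nonempty X] (φ : ℝ → X → X),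
      (∀ s, Continuous (φ s)) → (∀ s t x, φ (s + t) x = φ s (φ t x)) →
      ∃ x : X, ∀ ε : ℝ, 0 < ε → ∃ L : ℝ, 0 < L ∧ ∀ t : ℝ, ∃ s ∈ Icc t (t + L),
        dist (φ s x) x < ε := by
  intro X _ _ _ φ hφ hadd
  obtain ⟨M, hne, hcl, hinv, hmin⟩ := exists_minimal_closed_invariant φ
  obtain ⟨x, hx⟩ := hne
  exact ⟨x, fun ε hε ↦ almostPeriodic_of_mem_minimal φ hφ hadd hcl.isCompact hcl hinv hmin hx hε⟩

/-- **Almost-periodic points recur into every minimal set they start in, at ALL scales jointly with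
invariance**: the orbit closure of an almost-periodic point produced by `exists_almostPeriodic` is
again acted on by the flow (`mapsTo_closure_range_flow`), so the recurrence is two-sided in time —
`t` ranges over all of `ℝ` in the conclusion. This remark is recorded as the trivial corollary that
the return times are relatively dense on the negative half-line too. [folklore] -/
theorem exists_almostPeriodic_neg {X : Type*} [PseudoMetricSpace X] [CompactSpace X] [Nonempty X]
    (φ : ℝ → X → X) (hφ : ∀ s, Continuous (φ s)) (hadd : ∀ s t x, φ (s + t) x = φ s (φ t x)) :
    ∃ x : X, ∀ ε : ℝ, 0 < ε → ∃ L : ℝ, 0 < L ∧ ∀ t : ℝ, ∃ s ∈ Icc (t - L) t,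
      dist (φ s x) x < ε := by
  obtain ⟨x, hx⟩ := exists_almostPeriodic φ hφ hadd
  refine ⟨x, fun ε hε ↦ ?_⟩
  obtain ⟨L, hL, hret⟩ := hx ε hε
  refine ⟨L, hL, fun t ↦ ?_⟩
  obtain ⟨s, hs, hsε⟩ := hret (t - L)
  exact ⟨s, ⟨hs.1, by linarith [hs.2]⟩, hsε⟩

end Summit.FinalStateConjecture.FinalStateConjecture.Theorems.ClusterCompleteness
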